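import Summits.Ventures.DiscreteObjects.PP12.OrderThirteenBase
import Summits.Ventures.DiscreteObjects.PP12.OrderThirteenCollineation
import Summits.Ventures.DiscreteObjects.PP12.OrbitCountPrimeOrder
import Summits.Ventures.DiscreteObjects.PP12.RigidEndgameV10

/-!
# PP(12), order-13 cell: the plane ⇒ lift-array reduction in the kernel (`NoLiftData13 → NoOrderThirteenOrder12`)
Framing: lottery ticket; floor = certified bounds/negative ranges.

Cell pub-namedobj (venture DiscreteObjects), target (M), designs gen 16. Part 2 (part 1 = `OrderThirteenBase`: powers, fixed antiflag
`(P₀, l₀)`, base frame `Q ∈ l₀`, `N = P₀Q`, `P_t` (`t : Fin 11`) = points of `N` other than `P₀, Q`, `L_s` (`s : Fin 11`) = lines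
through `Q` other than `l₀, N`). Here, for a projective plane of order 12 with a collineation `σ ≠ 1`, `σ¹³ = 1`:

* **unique decomposition** (`decomp13`, `decomp13_unique`): every point `R ≠ P₀`, `R ∉ l₀` is `σ^x P_t` for exactly one pair
  `(t, x) ∈ Fin 11 × Fin 13`;
* `two_line13`: two distinct lines, the first not through `P₀`, meeting off `l₀`, share exactly one decomposed point; `one_line13`: a line
  not through `P₀` avoiding `σ^x Q` contains exactly one `σ^x P_t`;
* the plane's lift data `liftData13` (`mem s t x ↔ σ^x P_t ∈ L_s`, the encoding of FAMILY-B1P-PLUS §2 / `OrderThirteenCollineation`)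
  satisfy **`LiftData.Valid`** (`liftData13_valid`: (M·U) row partition, (U·U) internal differences, (U·U′) cross differences — each is
  an instance of the two lemmas above, with the exponent shift `σ^{x−δ} p ∈ m ↔ σ^x p ∈ σ^δ m`, `pow_sub_apply_mem_iff`);
* **`noOrderThirteen_of_noLiftData13 : NoLiftData13 → NoOrderThirteenOrder12`**, and the rigid endgame
  `card_collineationGroup_eq_one_v12` = `RigidEndgameV10.card_collineationGroup_eq_one_v10` with the plane-level hypothesis
  `h13 : NoOrderThirteenOrder12` REPLACED by the finite array statement `NoLiftData13`.

Census words unchanged: `NoLiftData13` is decided EMPTY outside the kernel (designs E1, two implementations + farm twin j098200) and the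
cell is excluded in print (Janko–van Trung 1981/82); nothing here asserts it. No `sorry`, no new axioms.
-/

namespace Summit.Ventures.DiscreteObjects.PP12

open Configuration Finset
open scoped Classical

namespace Collineation

variable {P L : Type*} [Membership P L] (σ : Collineation P L) [ProjectivePlane P L] [Fintype P] [Fintype L]

section Thirteen

variable (h12 : ProjectivePlane.order P L = 12) (hne : σ.onPoints ≠ 1) (hq : σ.onPoints ^ 13 = 1)

/-! ### Unique decomposition of the free points -/

/-- **Every point `R ≠ P₀` off `l₀` is `σ^x P_t`** for some `t : Fin 11`, `x : Fin 13`. -/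
theorem decomp13 {R : P} (hR : R ≠ σ.fpt13 h12 hne hq) (hRl : R ∉ σ.fln13 h12 hne hq) :
    ∃ (t : Fin 11) (x : Fin 13), (σ.onPoints ^ (x : ℕ)) (σ.pt13 h12 hne hq t) = R := by
  -- the pencil of P₀ is `{σL^x N : x : Fin 13}`
  let f : Fin 13 → {m : L // σ.fpt13 h12 hne hq ∈ m} := fun x =>
    ⟨(σ.onLines ^ (x : ℕ)) (σ.bln13 h12 hne hq), by
      have h := (σ.pow_mem_iff (x : ℕ) (σ.fpt13 h12 hne hq) (σ.bln13 h12 hne hq)).2 (σ.fpt13_mem_bln13 h12 hne hq)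
      rwa [σ.pow_fpt13 h12 hne hq] at h⟩
  have hf : Function.Injective f := fun x y hxy => by
    have e := congrArg Subtype.val hxy
    exact Fin.ext (σ.pow_bln13_injective h12 hne hq x.isLt y.isLt e)
  have hcard : Fintype.card (Fin 13) = Fintype.card {m : L // σ.fpt13 h12 hne hq ∈ m} := by
    rw [Fintype.card_fin, Fintype.card_subtype, card_lines_through (L := L), h12]
  have hbij : Function.Bijective f := (Fintype.bijective_iff_injective_and_card f).2 ⟨hf, hcard⟩
  -- the line `P₀ R`
  obtain ⟨x, hx⟩ := hbij.2 ⟨HasLines.mkLine hR, (HasLines.mkLine_ax hR).2⟩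
  have hRM : R ∈ (σ.onLines ^ (x : ℕ)) (σ.bln13 h12 hne hq) := by
    have e := congrArg Subtype.val hx
    simp only [f] at e
    rw [e]; exact (HasLines.mkLine_ax hR).1
  -- pull R back to N
  set p := (σ.onPoints ^ (x : ℕ)).symm R with hp
  have hpR : (σ.onPoints ^ (x : ℕ)) p = R := (σ.onPoints ^ (x : ℕ)).apply_symm_apply R
  have hpN : p ∈ σ.bln13 h12 hne hq := by
    rw [← σ.pow_mem_iff (x : ℕ), hpR]; exact hRM
  have hp0 : p ≠ σ.fpt13 h12 hne hq := by
    intro e; apply hR; rw [← hpR, e, σ.pow_fpt13 h12 hne hq]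
  have hpQ : p ≠ σ.bpt13 h12 hne hq := by
    intro e; apply hRl; rw [← hpR, e]; exact σ.pow_mem_fln13 h12 hne hq _ (σ.bpt13_mem_fln13 h12 hne hq)
  obtain ⟨t, ht⟩ := σ.exists_pt13_eq h12 hne hq hpN hp0 hpQ
  exact ⟨t, x, by rw [ht, hpR]⟩

/-- **… and the pair `(t, x)` is unique.** -/
theorem decomp13_unique {t t' : Fin 11} {x x' : Fin 13}
    (h : (σ.onPoints ^ (x : ℕ)) (σ.pt13 h12 hne hq t) = (σ.onPoints ^ (x' : ℕ)) (σ.pt13 h12 hne hq t')) : t = t' ∧ x = x' := by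
  -- both pencil lines `σL^x N`, `σL^x' N` contain `P₀` and the common point
  have h1 : (σ.onPoints ^ (x : ℕ)) (σ.pt13 h12 hne hq t) ∈ (σ.onLines ^ (x : ℕ)) (σ.bln13 h12 hne hq) :=
    (σ.pow_mem_iff _ _ _).2 (σ.pt13_mem_bln13 h12 hne hq t)
  have h2 : (σ.onPoints ^ (x : ℕ)) (σ.pt13 h12 hne hq t) ∈ (σ.onLines ^ (x' : ℕ)) (σ.bln13 h12 hne hq) := by
    rw [h]; exact (σ.pow_mem_iff _ _ _).2 (σ.pt13_mem_bln13 h12 hne hq t')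
  have h3 : σ.fpt13 h12 hne hq ∈ (σ.onLines ^ (x : ℕ)) (σ.bln13 h12 hne hq) := by
    have e := (σ.pow_mem_iff (x : ℕ) (σ.fpt13 h12 hne hq) (σ.bln13 h12 hne hq)).2 (σ.fpt13_mem_bln13 h12 hne hq)
    rwa [σ.pow_fpt13 h12 hne hq] at e
  have h4 : σ.fpt13 h12 hne hq ∈ (σ.onLines ^ (x' : ℕ)) (σ.bln13 h12 hne hq) := by
    have e := (σ.pow_mem_iff (x' : ℕ) (σ.fpt13 h12 hne hq) (σ.bln13 h12 hne hq)).2 (σ.fpt13_mem_bln13 h12 hne hq)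
    rwa [σ.pow_fpt13 h12 hne hq] at e
  have hlines := (Nondegenerate.eq_or_eq h1 h3 h2 h4).resolve_left (σ.pow_pt13_ne_fpt13 h12 hne hq _ t)
  have hxx' : x = x' := Fin.ext (σ.pow_bln13_injective h12 hne hq x.isLt x'.isLt hlines)
  subst hxx'
  exact ⟨σ.pt13_injective h12 hne hq ((σ.onPoints ^ (x : ℕ)).injective h), rfl⟩

/-- **Two-line lemma.** Two distinct lines, the first not through `P₀`, whose common point is off `l₀`, contain exactly one
common decomposed point `σ^x P_t`. -/
theorem two_line13 {m m' : L} (hmm' : m ≠ m') (hm : σ.fpt13 h12 hne hq ∉ m)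
    (hoff : ∀ R : P, R ∈ m → R ∈ m' → R ∉ σ.fln13 h12 hne hq) :
    ∃ (t : Fin 11) (x : Fin 13), ((σ.onPoints ^ (x : ℕ)) (σ.pt13 h12 hne hq t) ∈ m ∧
      (σ.onPoints ^ (x : ℕ)) (σ.pt13 h12 hne hq t) ∈ m') ∧
      ∀ (t' : Fin 11) (x' : Fin 13), (σ.onPoints ^ (x' : ℕ)) (σ.pt13 h12 hne hq t') ∈ m →
        (σ.onPoints ^ (x' : ℕ)) (σ.pt13 h12 hne hq t') ∈ m' → t' = t ∧ x' = x := by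
  set R : P := HasPoints.mkPoint hmm' with hRdef
  have hR1 : R ∈ m := (HasPoints.mkPoint_ax hmm').1
  have hR2 : R ∈ m' := (HasPoints.mkPoint_ax hmm').2
  have hR0 : R ≠ σ.fpt13 h12 hne hq := fun e => hm (e ▸ hR1)
  obtain ⟨t, x, htx⟩ := σ.decomp13 h12 hne hq hR0 (hoff R hR1 hR2)
  refine ⟨t, x, ⟨htx ▸ hR1, htx ▸ hR2⟩, fun t' x' h1 h2 => ?_⟩
  have e : (σ.onPoints ^ (x' : ℕ)) (σ.pt13 h12 hne hq t') = R :=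
    (Nondegenerate.eq_or_eq h1 hR1 h2 hR2).resolve_right hmm'
  exact σ.decomp13_unique h12 hne hq (e.trans htx.symm)

/-- **One-line lemma.** A line `m` not through `P₀` with `σ^x Q ∉ m` contains exactly one point `σ^x P_t` (its meet with the
pencil line `σ^x N`). -/
theorem one_line13 {m : L} (hm : σ.fpt13 h12 hne hq ∉ m) (x : ℕ) (hx : (σ.onPoints ^ x) (σ.bpt13 h12 hne hq) ∉ m) :
    ∃ t : Fin 11, (σ.onPoints ^ x) (σ.pt13 h12 hne hq t) ∈ m ∧
      ∀ t' : Fin 11, (σ.onPoints ^ x) (σ.pt13 h12 hne hq t') ∈ m → t' = t := by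
  set M : L := (σ.onLines ^ x) (σ.bln13 h12 hne hq) with hMdef
  have h0M : σ.fpt13 h12 hne hq ∈ M := by
    have e := (σ.pow_mem_iff x (σ.fpt13 h12 hne hq) (σ.bln13 h12 hne hq)).2 (σ.fpt13_mem_bln13 h12 hne hq)
    rwa [σ.pow_fpt13 h12 hne hq] at e
  have hMm : M ≠ m := fun e => hm (e ▸ h0M)
  set R : P := HasPoints.mkPoint hMm with hRdef
  have hR1 : R ∈ M := (HasPoints.mkPoint_ax hMm).1
  have hR2 : R ∈ m := (HasPoints.mkPoint_ax hMm).2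
  set p := (σ.onPoints ^ x).symm R with hp
  have hpR : (σ.onPoints ^ x) p = R := (σ.onPoints ^ x).apply_symm_apply R
  have hpN : p ∈ σ.bln13 h12 hne hq := by rw [← σ.pow_mem_iff x, hpR]; exact hR1
  have hp0 : p ≠ σ.fpt13 h12 hne hq := by
    intro e; apply hm; rw [← σ.pow_fpt13 h12 hne hq x, ← e, hpR]; exact hR2
  have hpQ : p ≠ σ.bpt13 h12 hne hq := by
    intro e; apply hx; rw [← e, hpR]; exact hR2
  obtain ⟨t, ht⟩ := σ.exists_pt13_eq h12 hne hq hpN hp0 hpQ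
  refine ⟨t, by rw [ht, hpR]; exact hR2, fun t' ht' => ?_⟩
  have h1 : (σ.onPoints ^ x) (σ.pt13 h12 hne hq t') ∈ M := (σ.pow_mem_iff _ _ _).2 (σ.pt13_mem_bln13 h12 hne hq t')
  have e : (σ.onPoints ^ x) (σ.pt13 h12 hne hq t') = R := (Nondegenerate.eq_or_eq h1 hR1 ht' hR2).resolve_right hMm
  apply σ.pt13_injective h12 hne hq
  apply (σ.onPoints ^ x).injective
  rw [e, ht, hpR]

/-! ### The lift data of the plane and their validity -/

/-- **The plane's lift data**: `mem s t x ↔ σ^x P_t ∈ L_s`. -/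
noncomputable def liftData13 : LiftData 11 13 where
  mem := fun s t x => decide ((σ.onPoints ^ (x : ℕ)) (σ.pt13 h12 hne hq t) ∈ σ.ln13 h12 hne hq s)

/-- unfolding `mem` -/
theorem liftData13_mem (s t : Fin 11) (x : Fin 13) :
    (σ.liftData13 h12 hne hq).mem s t x = true ↔ (σ.onPoints ^ (x : ℕ)) (σ.pt13 h12 hne hq t) ∈ σ.ln13 h12 hne hq s := by
  simp [liftData13]

omit [ProjectivePlane P L] [Fintype P] [Fintype L] in
include hq in
/-- shifting the exponent: `σ^{x-δ} p ∈ m ↔ σ^x p ∈ σL^δ m` (`x, δ ∈ Z₁₃`). -/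
theorem pow_sub_apply_mem_iff (x δ : Fin 13) (p : P) (m : L) :
    (σ.onPoints ^ ((x - δ : Fin 13) : ℕ)) p ∈ m ↔ (σ.onPoints ^ (x : ℕ)) p ∈ (σ.onLines ^ (δ : ℕ)) m := by
  rw [← σ.pow_mem_iff (δ : ℕ) ((σ.onPoints ^ ((x - δ : Fin 13) : ℕ)) p) m, ← Equiv.Perm.mul_apply, ← pow_add,
    pow_apply_eq_pow_mod σ.onPoints hq]
  have e : ((δ : ℕ) + ((x - δ : Fin 13) : ℕ)) % 13 = (x : ℕ) := by
    have h := Fin.val_add δ (x - δ)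
    rw [add_sub_cancel] at h
    exact h.symm
  rw [e]

/-- a non-zero residue is not a multiple of 13 -/
theorem not_dvd_of_fin13_ne_zero {δ : Fin 13} (hδ : δ ≠ 0) : ¬ 13 ∣ (δ : ℕ) := by
  intro h
  apply hδ
  have := δ.isLt
  ext
  simp only [Fin.val_zero]
  omega

/-- `σ^δ Q ∉ L_s` for `δ ≠ 0`. -/
theorem pow_bpt13_not_mem_ln13 (s : Fin 11) {δ : Fin 13} (hδ : δ ≠ 0) :
    (σ.onPoints ^ (δ : ℕ)) (σ.bpt13 h12 hne hq) ∉ σ.ln13 h12 hne hq s := fun h =>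
  σ.pow_bpt13_ne h12 hne hq (not_dvd_of_fin13_ne_zero hδ)
    (σ.eq_bpt13_of_mem_ln13_of_mem_fln13 h12 hne hq s h (σ.pow_mem_fln13 h12 hne hq _ (σ.bpt13_mem_fln13 h12 hne hq)))

/-- `Q ∉ σL^δ L_s` for `δ ≠ 0`. -/
theorem bpt13_not_mem_pow_ln13 (s : Fin 11) {δ : Fin 13} (hδ : δ ≠ 0) :
    σ.bpt13 h12 hne hq ∉ (σ.onLines ^ (δ : ℕ)) (σ.ln13 h12 hne hq s) := by
  intro h
  rw [σ.mem_pow_apply_iff] at h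
  set p := (σ.onPoints ^ (δ : ℕ)).symm (σ.bpt13 h12 hne hq) with hp
  have hpQ : (σ.onPoints ^ (δ : ℕ)) p = σ.bpt13 h12 hne hq := (σ.onPoints ^ (δ : ℕ)).apply_symm_apply _
  have hpl : p ∈ σ.fln13 h12 hne hq := by
    rw [← σ.pow_mem_iff (δ : ℕ), hpQ, σ.pow_fln13 h12 hne hq]; exact σ.bpt13_mem_fln13 h12 hne hq
  have e := σ.eq_bpt13_of_mem_ln13_of_mem_fln13 h12 hne hq s h hpl
  rw [e] at hpQ
  exact σ.pow_bpt13_ne h12 hne hq (not_dvd_of_fin13_ne_zero hδ) hpQ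

/-- The meet of `L_s` and `σL^δ L_{s'}` (`δ ≠ 0`) is off `l₀`. -/
theorem off_fln13_of_mem_ln13_of_mem_pow_ln13 (s s' : Fin 11) {δ : Fin 13} (hδ : δ ≠ 0) {R : P} (h1 : R ∈ σ.ln13 h12 hne hq s)
    (h2 : R ∈ (σ.onLines ^ (δ : ℕ)) (σ.ln13 h12 hne hq s')) : R ∉ σ.fln13 h12 hne hq := fun hRl => by
  have e := σ.eq_bpt13_of_mem_ln13_of_mem_fln13 h12 hne hq s h1 hRl
  rw [e] at h2
  exact σ.bpt13_not_mem_pow_ln13 h12 hne hq s' hδ h2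

/-- `L_s ≠ σL^δ L_{s'}` for `δ ≠ 0`. -/
theorem ln13_ne_pow_ln13 (s s' : Fin 11) {δ : Fin 13} (hδ : δ ≠ 0) :
    σ.ln13 h12 hne hq s ≠ (σ.onLines ^ (δ : ℕ)) (σ.ln13 h12 hne hq s') := fun e =>
  σ.bpt13_not_mem_pow_ln13 h12 hne hq s' hδ (e ▸ σ.bpt13_mem_ln13 h12 hne hq s)

/-- **(M·U)** row partition. -/
theorem liftData13_rowPartition (s : Fin 11) : (σ.liftData13 h12 hne hq).RowPartition s := by
  refine ⟨fun t => ?_, fun x hx => ?_⟩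
  · rw [Bool.eq_false_iff, Ne, liftData13_mem]
    simpa using σ.pt13_not_mem_ln13 h12 hne hq s t
  · obtain ⟨t, ht, huniq⟩ := σ.one_line13 h12 hne hq (σ.fpt13_not_mem_ln13 h12 hne hq s) (x : ℕ)
      (σ.pow_bpt13_not_mem_ln13 h12 hne hq s hx)
    exact ⟨t, (σ.liftData13_mem h12 hne hq s t x).2 ht, fun t' ht' => huniq t' ((σ.liftData13_mem h12 hne hq s t' x).1 ht')⟩

/-- **(U·U)** internal differences. -/
theorem liftData13_internal (s : Fin 11) : (σ.liftData13 h12 hne hq).Internal s := by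
  intro δ hδ
  obtain ⟨t, x, ⟨h1, h2⟩, huniq⟩ := σ.two_line13 h12 hne hq (σ.ln13_ne_pow_ln13 h12 hne hq s s hδ)
    (σ.fpt13_not_mem_ln13 h12 hne hq s) (fun R hR1 hR2 => σ.off_fln13_of_mem_ln13_of_mem_pow_ln13 h12 hne hq s s hδ hR1 hR2)
  refine ⟨t, x, (σ.liftData13_mem h12 hne hq s t x).2 h1, ?_, fun t' x' h1' h2' => huniq t' x'
    ((σ.liftData13_mem h12 hne hq s t' x').1 h1') ?_⟩
  · rw [liftData13_mem, σ.pow_sub_apply_mem_iff hq]; exact h2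
  · rw [liftData13_mem, σ.pow_sub_apply_mem_iff hq] at h2'; exact h2'

/-- **(U·U′)** cross differences. -/
theorem liftData13_cross {s s' : Fin 11} (hss' : s ≠ s') : (σ.liftData13 h12 hne hq).Cross s s' := by
  refine ⟨fun t x h => ?_, fun δ hδ => ?_⟩
  · rw [liftData13_mem, liftData13_mem] at h
    have e := σ.eq_bpt13_of_mem_ln13_of_mem_ln13 h12 hne hq hss' h.1 h.2
    exact σ.pow_pt13_not_mem_fln13 h12 hne hq _ t (e ▸ σ.bpt13_mem_fln13 h12 hne hq)
  · obtain ⟨t, x, ⟨h1, h2⟩, huniq⟩ := σ.two_line13 h12 hne hq (σ.ln13_ne_pow_ln13 h12 hne hq s s' hδ)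
      (σ.fpt13_not_mem_ln13 h12 hne hq s) (fun R hR1 hR2 => σ.off_fln13_of_mem_ln13_of_mem_pow_ln13 h12 hne hq s s' hδ hR1 hR2)
    refine ⟨t, x, (σ.liftData13_mem h12 hne hq s t x).2 h1, ?_, fun t' x' h1' h2' => huniq t' x'
      ((σ.liftData13_mem h12 hne hq s t' x').1 h1') ?_⟩
    · rw [liftData13_mem, σ.pow_sub_apply_mem_iff hq]; exact h2
    · rw [liftData13_mem, σ.pow_sub_apply_mem_iff hq] at h2'; exact h2'

/-- **The plane's lift data are a valid normal form.** -/
theorem liftData13_valid : (σ.liftData13 h12 hne hq).Valid :=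
  ⟨fun s => ⟨σ.liftData13_rowPartition h12 hne hq s, σ.liftData13_internal h12 hne hq s⟩,
    fun _ _ hss' => σ.liftData13_cross h12 hne hq hss'⟩

end Thirteen

end Collineation

/-- **Kernel reduction of the order-13 cell: `NoLiftData13 → NoOrderThirteenOrder12`.** -/
theorem noOrderThirteen_of_noLiftData13 (h : NoLiftData13) : NoOrderThirteenOrder12 := by
  intro P L _ _ _ _ h12 σ hq
  by_contra hne
  exact h _ (σ.liftData13_valid h12 hne hq)

open Literature.Combinatorics.Designs Summit.Ventures.DiscreteObjects.STD in
/-- **Rigid endgame, v12:** `RigidEndgameV10.card_collineationGroup_eq_one_v10` with the plane-level order-13 hypothesis replaced by the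
finite lift-array statement `NoLiftData13`. -/
theorem card_collineationGroup_eq_one_v12 (h2 : NoLiftableSTD2_12_6) (h3E : NoLiftableSTD3_12_4)
    (h4 : NoFlagOrbitMatrix 4) (h3 : NoFlagOrbitMatrix 3) (h7 : NoFlagSevenOrbitMatrix) (h10 : NoFlagTenOrbitMatrix)
    (h5 : NoFanoFiveIncMatrix) (h11 : NoOrderElevenOrder12) (h13 : NoLiftData13)
    (P L : Type) [Membership P L] [Fintype P] [Fintype L] [ProjectivePlane P L] (h12 : ProjectivePlane.order P L = 12)
    (G : Type) [Group G] [Fintype G] [MulAction G P] [MulAction G L] (hG : IsCollineationGroup G P L) :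
    Fintype.card G = 1 :=
  card_collineationGroup_eq_one_v10 h2 h3E h4 h3 h7 h10 h5 h11 (noOrderThirteen_of_noLiftData13 h13) P L h12 G hG

end Summit.Ventures.DiscreteObjects.PP12
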